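import Literature.Topology.FourManifolds.Spin
import Mathlib.Geometry.Manifold.ContMDiffMFDeriv
import Mathlib.Geometry.Manifold.MFDeriv.Atlas
import HarnessLib

/-!
# Re-modelling a boundaryless manifold on another model vector space

Topic `Literature/Topology/Immersions`; a utility for applying theorems stated for manifolds
charted on a *fixed* model `ℝᵐ = EuclideanSpace ℝ (Fin m)` (such as the tree's Phillips theorem
`Literature.Topology.Immersions.Phillips1967_exists_isLocalDiffeomorph_of_isParallelizable_holds`,
or the closed-manifold library of `Literature/Topology/FourManifolds`) to manifolds that Mathlib
charts on another model: products `M × ℝᵏ` (charted on `ModelProd ℝⁿ ℝᵏ`), total spaces of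
bundles, open subsets, level sets.

Given a boundaryless model with corners `I : ModelWithCorners ℝ E H` and a continuous linear
isomorphism `L : E ≃L[ℝ] E'`, the type synonym `Remodel I L M` carries the charted space structure
on `E'` whose charts are the charts of `M` followed by the homeomorphism `L ∘ I : H ≃ₜ E'`
(`Remodel.chartedSpace`); it is a `C^n` manifold for the self-model `𝓘(ℝ, E')` when `M` is `C^n` for
`I` (`Remodel.isManifold`: the chart changes are the old ones conjugated by `L ∘ I`), the identity
maps `toRemodel`, `ofRemodel` are `C^∞` with differentials `L`, `L⁻¹` (`contMDiff_toRemodel`,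
`mfderiv_toRemodel`, …), so that `C^n` maps, immersions and local diffeomorphisms into and out of
`M` are the same as those of `Remodel I L M` (`contMDiff_comp_toRemodel_iff`, …), and a
parallelization of `M` is carried to one of `Remodel I L M` by the tangent map of the identity
(`isParallelizable_remodel`, for the tree's `Literature.Topology.FourManifolds.IsParallelizable`).

Everything here is proved; no named facts are introduced. (Lee, *Introduction to Smooth
Manifolds* (2013), Ch. 1: smooth structures transported along homeomorphisms of the model; the
content is bookkeeping.)

## References

* J. M. Lee, *Introduction to Smooth Manifolds*, 2nd ed., GTM 218 (2013), Ch. 1 (Example 1.34,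
  products; smooth structures and diffeomorphic models). [LeeSmoothManifolds2013]
-/

open scoped Manifold ContDiff Topology
open Set Function Module Bundle

noncomputable section

namespace Literature.Topology.Immersions

variable {E E' : Type*} [NormedAddCommGroup E] [NormedSpace ℝ E] [NormedAddCommGroup E']
  [NormedSpace ℝ E'] {H : Type*} [TopologicalSpace H]

/-- **The re-modelled manifold**: the type `M` itself, to be charted on `E'` through
`L ∘ I : H ≃ₜ E'`. [folklore] -/
@[nolint unusedArguments]
def Remodel (_I : ModelWithCorners ℝ E H) (_L : E ≃L[ℝ] E') (M : Type*) : Type _ := M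

namespace Remodel

variable (I : ModelWithCorners ℝ E H) (L : E ≃L[ℝ] E') (M : Type*)

/-- The identity `M → Remodel I L M`. [folklore] -/
def toRemodel : M → Remodel I L M := id

variable {I L M} in
/-- The identity `Remodel I L M → M`. [folklore] -/
def ofRemodel (x : Remodel I L M) : M := x

variable {I L M} in
/-- `ofRemodel ∘ toRemodel = id`. [folklore] -/
@[simp] theorem ofRemodel_toRemodel (x : M) : ofRemodel (toRemodel I L M x) = x := rfl

variable {I L M} in
/-- `toRemodel ∘ ofRemodel = id`. [folklore] -/
@[simp] theorem toRemodel_ofRemodel (x : Remodel I L M) : toRemodel I L M (ofRemodel x) = x := rfl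

variable {I L M} in
/-- The identity `M → Remodel I L M` is bijective. [folklore] -/
theorem toRemodel_bijective : Bijective (toRemodel I L M) := bijective_id

variable {I L M} in
/-- The identity `Remodel I L M → M` is bijective. [folklore] -/
theorem ofRemodel_bijective : Bijective (ofRemodel : Remodel I L M → M) := bijective_id

/-- The re-modelled manifold has the topology of `M`. [folklore] -/
instance [t : TopologicalSpace M] : TopologicalSpace (Remodel I L M) := t

/-- Hausdorffness is that of `M`. [folklore] -/
instance [TopologicalSpace M] [T2Space M] : T2Space (Remodel I L M) := ‹T2Space M›

/-- Second countability is that of `M`. [folklore] -/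
instance [TopologicalSpace M] [SecondCountableTopology M] : SecondCountableTopology (Remodel I L M) :=
  ‹SecondCountableTopology M›

/-- Compactness is that of `M`. [folklore] -/
instance [TopologicalSpace M] [CompactSpace M] : CompactSpace (Remodel I L M) := ‹CompactSpace M›

/-- σ-compactness is that of `M`. [folklore] -/
instance [TopologicalSpace M] [SigmaCompactSpace M] : SigmaCompactSpace (Remodel I L M) :=
  ‹SigmaCompactSpace M›

/-- Nonemptiness is that of `M`. [folklore] -/
instance [Nonempty M] : Nonempty (Remodel I L M) := ‹Nonempty M›

/-- The identity `M → Remodel I L M` is a homeomorphism. [folklore] -/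
def homeomorph [TopologicalSpace M] : M ≃ₜ Remodel I L M := Homeomorph.refl M

/-- Unfolding of `homeomorph`. [folklore] -/
@[simp] theorem homeomorph_apply [TopologicalSpace M] (x : M) : homeomorph I L M x = toRemodel I L M x := rfl

/-- The identity `M → Remodel I L M` is continuous. [folklore] -/
theorem continuous_toRemodel [TopologicalSpace M] : Continuous (toRemodel I L M) := continuous_id

/-- The identity `Remodel I L M → M` is continuous. [folklore] -/
theorem continuous_ofRemodel [TopologicalSpace M] : Continuous (ofRemodel : Remodel I L M → M) :=
  continuous_id

variable [I.Boundaryless]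

/-- The change of model `L ∘ I : H ≃ₜ E'`. [folklore] -/
def modelHomeo : H ≃ₜ E' := I.toHomeomorph.trans L.toHomeomorph

/-- Unfolding of `modelHomeo`. [folklore] -/
@[simp] theorem modelHomeo_apply (x : H) : modelHomeo I L x = L (I x) := rfl

/-- Unfolding of the inverse of `modelHomeo`. [folklore] -/
@[simp] theorem modelHomeo_symm_apply (y : E') : (modelHomeo I L).symm y = I.symm (L.symm y) := rfl

variable [TopologicalSpace M] [ChartedSpace H M]

/-- **The re-modelled atlas**: charts of `M` followed by `L ∘ I`. [folklore] -/
instance chartedSpace : ChartedSpace E' (Remodel I L M) where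
  atlas := (fun c : OpenPartialHomeomorph M H => c ≫ₕ (modelHomeo I L).toOpenPartialHomeomorph) ''
    atlas H M
  chartAt x := @chartAt H _ M _ _ (ofRemodel x) ≫ₕ (modelHomeo I L).toOpenPartialHomeomorph
  mem_chart_source x := by
    rw [OpenPartialHomeomorph.trans_source]
    exact ⟨mem_chart_source H (ofRemodel x), by simp⟩
  chart_mem_atlas x := mem_image_of_mem _ (chart_mem_atlas H (ofRemodel x))

variable {M} in
/-- The preferred chart of the re-modelled manifold. [folklore] -/
theorem chartAt_eq (x : Remodel I L M) :
    chartAt E' x = @chartAt H _ M _ _ (ofRemodel x) ≫ₕ (modelHomeo I L).toOpenPartialHomeomorph := rfl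

variable {M} in
/-- Values of the re-modelled charts. [folklore] -/
@[simp] theorem chartAt_apply (x y : Remodel I L M) :
    chartAt E' x y = L (I (@chartAt H _ M _ _ (ofRemodel x) (ofRemodel y))) := rfl

variable {M} in
/-- Values of the inverse re-modelled charts. [folklore] -/
@[simp] theorem chartAt_symm_apply (x : Remodel I L M) (z : E') :
    (chartAt E' x).symm z = toRemodel I L M ((@chartAt H _ M _ _ (ofRemodel x)).symm (I.symm (L.symm z))) :=
  rfl

variable {M} in
/-- The re-modelled charts have the old domains. [folklore] -/
theorem chartAt_source (x : Remodel I L M) :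
    (chartAt E' x).source = ((@chartAt H _ M _ _ (ofRemodel x)).source : Set M) := by
  rw [chartAt_eq, OpenPartialHomeomorph.trans_source]
  simp

variable {M} in
/-- Values of the re-modelled extended charts. [folklore] -/
theorem extChartAt_apply (x y : Remodel I L M) :
    extChartAt 𝓘(ℝ, E') x y = L (extChartAt I (ofRemodel x) (ofRemodel y)) := by
  simp [extChartAt, OpenPartialHomeomorph.extend, chartAt_apply]

variable {M} in
/-- Values of the inverse re-modelled extended charts. [folklore] -/
theorem extChartAt_symm_apply (x : Remodel I L M) (z : E') :
    (extChartAt 𝓘(ℝ, E') x).symm z = toRemodel I L M ((extChartAt I (ofRemodel x)).symm (L.symm z)) := by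
  simp [extChartAt, OpenPartialHomeomorph.extend, chartAt_symm_apply]

variable {M} in
/-- The re-modelled extended charts have the old domains. [folklore] -/
theorem extChartAt_source_eq (x : Remodel I L M) :
    (extChartAt 𝓘(ℝ, E') x).source = ((extChartAt I (ofRemodel x)).source : Set M) := by
  rw [extChartAt_source, extChartAt_source, chartAt_source]

/-- **Conjugating a `C^n` chart change by the change of model.** If `g : H → H` is read through
`I` as a `C^n` map on `I.symm ⁻¹' s`, then `(L ∘ I) ∘ g ∘ (L ∘ I)⁻¹` is `C^n` on the corresponding
subset of `E'`. [folklore] -/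
theorem contDiffOn_conj {n : ℕ∞ω} {g : H → H} {s : Set H}
    (hg : ContDiffOn ℝ n (I ∘ g ∘ I.symm) (I.symm ⁻¹' s ∩ range I)) :
    ContDiffOn ℝ n (fun z : E' => L (I (g (I.symm (L.symm z))))) ((fun z => I.symm (L.symm z)) ⁻¹' s) := by
  have h1 : ContDiffOn ℝ n ((I ∘ g ∘ I.symm) ∘ (L.symm : E' → E))
      ((fun z : E' => I.symm (L.symm z)) ⁻¹' s) :=
    hg.comp L.symm.contDiff.contDiffOn fun z hz => ⟨hz, by simp [I.range_eq_univ]⟩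
  exact L.contDiff.comp_contDiffOn h1

/-- **The re-modelled manifold is `C^n`.** [folklore] -/
instance isManifold {n : ℕ∞ω} [IsManifold I n M] : IsManifold 𝓘(ℝ, E') n (Remodel I L M) := by
  refine isManifold_of_contDiffOn 𝓘(ℝ, E') n (Remodel I L M) ?_
  intro e e' he he'
  obtain ⟨c, hc, rfl⟩ :=
    (he : e ∈ (fun c : OpenPartialHomeomorph M H => c ≫ₕ (modelHomeo I L).toOpenPartialHomeomorph) ''
      atlas H M)
  obtain ⟨c', hc', rfl⟩ :=
    (he' : e' ∈ (fun c : OpenPartialHomeomorph M H => c ≫ₕ (modelHomeo I L).toOpenPartialHomeomorph) ''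
      atlas H M)
  have hcompat := HasGroupoid.compatible (G := contDiffGroupoid n I) hc hc'
  rw [contDiffGroupoid, mem_groupoid_of_pregroupoid] at hcompat
  obtain ⟨h1, -⟩ := hcompat
  have key := contDiffOn_conj I L (g := c.symm ≫ₕ c') h1
  simp only [modelWithCornersSelf_coe, modelWithCornersSelf_coe_symm, CompTriple.comp_eq,
    preimage_id_eq, id_eq, range_id, inter_univ]
  refine key.congr_mono ?_ ?_
  · intro z hz
    rfl
  · intro z hz
    simp only [OpenPartialHomeomorph.trans_source, OpenPartialHomeomorph.symm_source,
      Homeomorph.toOpenPartialHomeomorph_target,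
      Homeomorph.toOpenPartialHomeomorph_symm_apply, mem_inter_iff, mem_preimage, mem_univ,
      true_and, OpenPartialHomeomorph.trans_symm_eq_symm_trans_symm,
      OpenPartialHomeomorph.coe_trans, Function.comp_apply] at hz ⊢
    simp only [modelHomeo_symm_apply] at hz
    exact ⟨hz.1, hz.2.1⟩

/-! ### The identity maps are smooth with differentials `L`, `L⁻¹` -/

section Smooth

variable {n : ℕ∞ω} {M}

/-- The local representative of the identity `M → Remodel` in the charts at `x` is `L` near the
point. [folklore] -/
theorem writtenInExtChartAt_toRemodel (x : M) :
    writtenInExtChartAt I 𝓘(ℝ, E') x (toRemodel I L M) =ᶠ[𝓝 (extChartAt I x x)] (L : E → E') := by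
  have hopen : IsOpen (extChartAt I x).target := by
    simpa [I.range_eq_univ] using isOpen_extChartAt_target (I := I) x
  filter_upwards [hopen.mem_nhds (mem_extChartAt_target x)] with z hz
  simp only [writtenInExtChartAt, Function.comp_apply, extChartAt_apply, ofRemodel_toRemodel]
  rw [(extChartAt I x).right_inv hz]

/-- The local representative of the identity `Remodel → M` in the charts at `x` is `L⁻¹` near the
point. [folklore] -/
theorem writtenInExtChartAt_ofRemodel (x : Remodel I L M) :
    writtenInExtChartAt 𝓘(ℝ, E') I x (ofRemodel : Remodel I L M → M) =ᶠ[𝓝 (extChartAt 𝓘(ℝ, E') x x)]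
      (L.symm : E' → E) := by
  have hopen : IsOpen (extChartAt I (ofRemodel x)).target := by
    simpa [I.range_eq_univ] using isOpen_extChartAt_target (I := I) (ofRemodel x)
  have hmem : L.symm (extChartAt 𝓘(ℝ, E') x x) ∈ (extChartAt I (ofRemodel x)).target := by
    rw [extChartAt_apply, L.symm_apply_apply]
    exact mem_extChartAt_target _
  have hcont : ContinuousAt (L.symm : E' → E) (extChartAt 𝓘(ℝ, E') x x) := L.symm.continuous.continuousAt
  filter_upwards [hcont.preimage_mem_nhds (hopen.mem_nhds hmem)] with z hz
  simp only [writtenInExtChartAt, Function.comp_apply, extChartAt_symm_apply, ofRemodel_toRemodel]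
  rw [(extChartAt I (ofRemodel x)).right_inv hz]

/-- **The identity `M → Remodel I L M` is `C^n`.** [folklore] -/
theorem contMDiff_toRemodel : ContMDiff I 𝓘(ℝ, E') n (toRemodel I L M) := by
  intro x
  rw [contMDiffAt_iff]
  refine ⟨continuous_id.continuousAt, ?_⟩
  have h := (L.contDiff (n := n)).contDiffAt (x := extChartAt I x x) |>.contDiffWithinAt (s := range I)
  exact h.congr_of_eventuallyEq_of_mem
    ((writtenInExtChartAt_toRemodel I L x).filter_mono inf_le_left) (by simp [I.range_eq_univ])

/-- **The identity `Remodel I L M → M` is `C^n`.** [folklore] -/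
theorem contMDiff_ofRemodel : ContMDiff 𝓘(ℝ, E') I n (ofRemodel : Remodel I L M → M) := by
  intro x
  rw [contMDiffAt_iff]
  refine ⟨continuous_id.continuousAt, ?_⟩
  have h := (L.symm.contDiff (n := n)).contDiffAt (x := extChartAt 𝓘(ℝ, E') x x)
    |>.contDiffWithinAt (s := range 𝓘(ℝ, E'))
  exact h.congr_of_eventuallyEq_of_mem
    ((writtenInExtChartAt_ofRemodel I L x).filter_mono inf_le_left) (by simp)

/-- `C^n` maps into `M` are `C^n` maps into `Remodel I L M`. [folklore] -/
theorem contMDiff_comp_toRemodel_iff {F HF : Type*} [NormedAddCommGroup F] [NormedSpace ℝ F]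
    [TopologicalSpace HF] {J : ModelWithCorners ℝ F HF} {N : Type*} [TopologicalSpace N]
    [ChartedSpace HF N] {f : N → M} :
    ContMDiff J 𝓘(ℝ, E') n (toRemodel I L M ∘ f) ↔ ContMDiff J I n f :=
  ⟨fun h => (contMDiff_ofRemodel I L).comp h, fun h => (contMDiff_toRemodel I L).comp h⟩

/-- `C^n` maps out of `Remodel I L M` are `C^n` maps out of `M`. [folklore] -/
theorem contMDiff_comp_ofRemodel_iff {F HF : Type*} [NormedAddCommGroup F] [NormedSpace ℝ F]
    [TopologicalSpace HF] {J : ModelWithCorners ℝ F HF} {N : Type*} [TopologicalSpace N]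
    [ChartedSpace HF N] {f : M → N} :
    ContMDiff 𝓘(ℝ, E') J n (f ∘ (ofRemodel : Remodel I L M → M)) ↔ ContMDiff I J n f :=
  ⟨fun h => by simpa [Function.comp_def] using h.comp (contMDiff_toRemodel I L (M := M)),
    fun h => h.comp (contMDiff_ofRemodel I L)⟩

variable (hn : 1 ≤ n)
include hn

/-- **The differential of the identity `M → Remodel I L M` is `L`.** [folklore] -/
theorem mfderiv_toRemodel (x : M) :
    mfderiv I 𝓘(ℝ, E') (toRemodel I L M) x = (L : E →L[ℝ] E') := by
  have hmd : MDifferentiableAt I 𝓘(ℝ, E') (toRemodel I L M) x :=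
    (contMDiff_toRemodel I L x).mdifferentiableAt (by positivity)
  rw [hmd.mfderiv]
  have h1 : fderivWithin ℝ (writtenInExtChartAt I 𝓘(ℝ, E') x (toRemodel I L M)) (range I)
      (extChartAt I x x) = fderiv ℝ (writtenInExtChartAt I 𝓘(ℝ, E') x (toRemodel I L M))
      (extChartAt I x x) := by
    rw [I.range_eq_univ, fderivWithin_univ]
  rw [h1, (writtenInExtChartAt_toRemodel I L x).fderiv_eq]
  exact L.fderiv

/-- **The differential of the identity `Remodel I L M → M` is `L⁻¹`.** [folklore] -/
theorem mfderiv_ofRemodel (x : Remodel I L M) :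
    mfderiv 𝓘(ℝ, E') I (ofRemodel : Remodel I L M → M) x = (L.symm : E' →L[ℝ] E) := by
  have hmd : MDifferentiableAt 𝓘(ℝ, E') I (ofRemodel : Remodel I L M → M) x :=
    (contMDiff_ofRemodel I L x).mdifferentiableAt (by positivity)
  rw [hmd.mfderiv]
  have h1 : fderivWithin ℝ (writtenInExtChartAt 𝓘(ℝ, E') I x (ofRemodel : Remodel I L M → M))
      (range 𝓘(ℝ, E')) (extChartAt 𝓘(ℝ, E') x x) =
      fderiv ℝ (writtenInExtChartAt 𝓘(ℝ, E') I x (ofRemodel : Remodel I L M → M))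
        (extChartAt 𝓘(ℝ, E') x x) := by
    simp [fderivWithin_univ]
  rw [h1, (writtenInExtChartAt_ofRemodel I L x).fderiv_eq]
  exact L.symm.fderiv

/-- The differential of the identity `M → Remodel I L M` is bijective. [folklore] -/
theorem bijective_mfderiv_toRemodel (x : M) :
    Bijective (mfderiv I 𝓘(ℝ, E') (toRemodel I L M) x) := by
  rw [mfderiv_toRemodel I L hn x]
  exact L.bijective

/-- The differential of the identity `Remodel I L M → M` is bijective. [folklore] -/
theorem bijective_mfderiv_ofRemodel (x : Remodel I L M) :
    Bijective (mfderiv 𝓘(ℝ, E') I (ofRemodel : Remodel I L M → M) x) := by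
  rw [mfderiv_ofRemodel I L hn x]
  exact L.symm.bijective

end Smooth

/-! ### Parallelizations are carried along -/

section Parallelizable

open Literature.Topology.FourManifolds

variable {M} [IsManifold I 1 M]

/-- **A parallelization of `M` re-models to a parallelization of `Remodel I L M`**: push the frame
forward by the tangent map of the identity (differential `L`), reindexing by `dim E = dim E'`.
[folklore] -/
theorem isParallelizable_remodel (h : IsParallelizable I M) :
    IsParallelizable 𝓘(ℝ, E') (Remodel I L M) := by
  obtain ⟨s, hs, hli⟩ := h
  have hrank : finrank ℝ E' = finrank ℝ E := L.symm.toLinearEquiv.finrank_eq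
  let e : Fin (finrank ℝ E') ≃ Fin (finrank ℝ E) := finCongr hrank
  -- the tangent map of the identity is continuous and reads `(x, v) ↦ (x, L v)`
  have hΦ : Continuous (tangentMap I 𝓘(ℝ, E') (toRemodel I L M)) :=
    (contMDiff_toRemodel I L (n := 1) (M := M)).continuous_tangentMap le_rfl
  have hΦapply : ∀ (x : M) (v : E), tangentMap I 𝓘(ℝ, E') (toRemodel I L M) ⟨x, v⟩ =
      (⟨toRemodel I L M x, L v⟩ : TangentBundle 𝓘(ℝ, E') (Remodel I L M)) := by
    intro x v
    simp only [tangentMap, mfderiv_toRemodel I L le_rfl x]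
    rfl
  refine ⟨fun i p => L (s (e i) (ofRemodel p)), fun i => ?_, fun p => ?_⟩
  · have hc : Continuous fun p : Remodel I L M =>
        tangentMap I 𝓘(ℝ, E') (toRemodel I L M) ⟨ofRemodel p, s (e i) (ofRemodel p)⟩ :=
      hΦ.comp ((hs (e i)).comp (continuous_ofRemodel I L M))
    refine hc.congr fun p => ?_
    rw [hΦapply]
    rfl
  · have h1 : LinearIndependent ℝ fun i => s (e i) (ofRemodel p) :=
      (hli (ofRemodel p)).comp e e.injective
    have h2 := h1.map' (L : E →ₗ[ℝ] E') (LinearMap.ker_eq_bot.2 L.injective)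
    simpa [Function.comp_def] using h2

end Parallelizable

end Remodel

end Literature.Topology.Immersions
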